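import Summits.HodgeConjecture.HodgeConjecture.Theorems.F0P3bKTypeCalculus
import Literature.NumberTheory.Automorphic.GKModulesAdCompatOfWeakDeriv
import Mathlib.Tactic.Module
import HarnessLib

/-!
# `K`-integration of Kovačević's `K`-type modules, I: the `K`-action of `U(2) × U(1)` on `V = ⊕ V_{n,m}` in the `u`-basis

Route `F0_ThetaPinDelta`, line `Cruxes/H413/Lines/F0_LocalAPackets.lean` (crux item H413), stub `StubT3aRealisationDatum`,
waypoint **W1** (`StubW1KIntegration`: `K`-integration of Kovačević's ladder module `Z(3) = ladderPlus`; lead A-p03 (g18),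
pen F0P3b-plan (g5)).  Namespace `Summit.HodgeConjecture.HodgeConjecture.Cruxes.H413.F0P3bKTypeIntegration`.  DEF lane (honest
definitions with bodies: `KIdx`, `kvec`, `cnorm`, `kTypeMat`, `kTypeImg`, `kTypeEnd`, `kTypeRep`, and the interface predicate
`ActsOnKTypes`; no instance, no notation, no named fact, no `sorry`).  KOVAČEVIĆ-FREE: the module
`Literature.RepresentationTheory.Kovacevic2021.SU21ModulesFromKTypes` is not imported; everything is stated over the label type `KIdx S`
and the basis vectors `kvec S n m k`, which for `S := 𝒟.S` are reducibly that module's `SU21Datum.Idx 𝒟` ∕ `SU21Datum.vec 𝒟`, so that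
`KIdx ladderPlus.S →₀ ℂ` IS `ladderPlus.V`.  The `(𝔤, K)`-module theorem is in the sequel ★ `F0P3bKTypeIntegrationGK`.

## Mathematics (Borel–Wallach 0 §2.5, VI 4.7–4.8; Kovačević §3 Def. 1, §6)

A `K`-type datum is a set `S ⊂ ℤ²` of labels `(n, m)` (`n` = dimension, `m` = eigenvalue of `Z = H_α + 2H_β`); the module is
`V = ⊕_{(n,m) ∈ S} V_{n,m}`, `V_{n,m} = ⟨u^1_{n,m}, …, u^n_{n,m}⟩`, and `𝔨 = 𝔤𝔩(2) ⊕ 𝔤𝔩(1)` acts by Kovačević's `u`-basis formulas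
`H_α u^k = (n+1−2k) u^k`, `X_α u^k = −(k−1)(n+1−k) u^{k−1}`, `Y_α u^k = −u^{k+1}`, `Z u^k = m u^k`, centre `↦ 0` (`ActsOnKTypes`).
When `6 ∣ m − 3n + 3` the `K`-type `V_{n,m}` integrates to `det(k₁₁)^a ⊗ u(k)^b ⊗ Sym^{n−1}(k₁₁)` of `K = U(2) × U(1)`,
`a = (m − 3n + 3)/6`, `b = −m/3`; in the `u`-basis, via the dictionary `u^k ↔ (−1)^{k−1} (n−1)!/(n−k)! · X₀^{n−k} X₁^{k−1}` (`cnorm`),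
its matrix is `kTypeMat n m g = diag(cnorm)⁻¹ · upqKTypeCoeff (n−1) a b g · diag(cnorm)` (★ `F0P3bKTypeCalculus`).  This file builds
the representation `kTypeRep S : K →* End V` (§3–§4: `kTypeMat_one/_mul`, `kTypeEnd_one/_mul`), proves `K`-finiteness
(`finiteDimensional_span_orbit`: the orbit of `v` stays in the finitely many blocks through `supp v`) and weak continuity
(`continuous_coeff`, from ★ `continuous_upqKTypeCoeff_apply`), and records the entrywise derivative along `exp tX`, `X ∈ 𝔨`
(`hasDerivAt_kTypeMat_expK`, from ★ `hasDerivAt_upqKTypeCoeff_expK`).  Exponents for Kovačević's six cohomological data (all integral):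
`holDS (a, b) = (1, −n−1)`, `antiholDS (−n, n+1)`, `ladderPlus (0, 1−n)`, `ladderMinus (1−n, n−1)`, `midDS (−1−q, q−p)`, `trivialMod (0, 0)`.

HONEST LABEL: HC_CM is proved only modulo the printed citations until rung 0 closes; this file is one waypoint of one engine stub.

[cite: BorelWallach2000, 0 §2.5; VI §4 4.7–4.8] [cite: Kovacevic2021, §3 Def. 1; §6]
-/

noncomputable section

open scoped MatrixGroups Matrix

namespace Summit.HodgeConjecture.HodgeConjecture.Cruxes.H413.F0P3bKTypeIntegration

open Literature.NumberTheory.Automorphic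
open Literature.RepresentationTheory.BorelWallach2000
open Literature.RepresentationTheory.KonnoKonno2007 Literature.RepresentationTheory.KonnoKonno2007.RealDualPair
open Literature.RepresentationTheory.KonnoKonno2007.RealDualPair.UForm
open Literature.RepresentationTheory.AlgebraicGroups.SL2Sym
open Summit.HodgeConjecture.HodgeConjecture.Cruxes.H413.F0P3bSymPowerDerivation
open Summit.HodgeConjecture.HodgeConjecture.Cruxes.H413.F0P3bSymPowerCalculus
open Summit.HodgeConjecture.HodgeConjecture.Cruxes.H413.F0P3bKTypeCalculus

-- Mathlib idiom (as in `GKModules`, the `Upq*` files and ★ `GKModulesAdCompatOfWeakDeriv`): the commutator bracket on `Module.End`,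
-- needed to state `𝔤 →ₗ⁅ℝ⁆ Module.End ℂ V`
attribute [local instance 100] LieRing.ofAssociativeRing

set_option autoImplicit false
set_option linter.dupNamespace false

/-! ## §1 The carrier: labels `(n, m, k)` and basis vectors `u^k_{n,m}` (Kovačević's `Idx` / `vec`, datum-free) -/

section Carrier

/-- **The basis labels of a `K`-type datum `S`**: triples `(n, m, k)` with `(n, m) ∈ S` and `1 ≤ k ≤ n` — for `S := 𝒟.S` this is
reducibly Kovačević's `SU21Datum.Idx 𝒟`, so that `KIdx 𝒟.S →₀ ℂ` is his carrier `𝒟.V`. [cite: Kovacevic2021, §3 Def. 1] -/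
abbrev KIdx (S : Set (ℤ × ℤ)) : Type := {t : ℤ × ℤ × ℤ // (t.1, t.2.1) ∈ S ∧ 1 ≤ t.2.2 ∧ t.2.2 ≤ t.1}

variable (S : Set (ℤ × ℤ))

open Classical in
/-- **The basis vector `u^k_{n,m}`** (zero off the admissible labels) — for `S := 𝒟.S` the body of Kovačević's `SU21Datum.vec`.
[cite: Kovacevic2021, §3 Def. 1] -/
def kvec (n m k : ℤ) : KIdx S →₀ ℂ :=
  if h : (n, m) ∈ S ∧ 1 ≤ k ∧ k ≤ n then Finsupp.single (⟨(n, m, k), h⟩ : KIdx S) 1 else 0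

variable {S}

/-- On an admissible label `kvec` is the basis vector. [cite: Kovacevic2021, §3 Def. 1] -/
theorem kvec_of_pos {n m k : ℤ} (h : (n, m) ∈ S ∧ 1 ≤ k ∧ k ≤ n) :
    kvec S n m k = Finsupp.single (⟨(n, m, k), h⟩ : KIdx S) 1 := by
  rw [kvec, dif_pos h]

/-- Off the admissible labels `kvec` vanishes. [cite: Kovacevic2021, §3 Def. 1] -/
theorem kvec_of_neg {n m k : ℤ} (h : ¬ ((n, m) ∈ S ∧ 1 ≤ k ∧ k ≤ n)) : kvec S n m k = 0 := by
  rw [kvec, dif_neg h]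

/-- `kvec S n m k` is the basis vector of any label `t` whose value is `(n, m, k)`. [cite: Kovacevic2021, §3 Def. 1] -/
theorem kvec_eq_single (t : KIdx S) {n m k : ℤ} (h : t.1 = (n, m, k)) : kvec S n m k = Finsupp.single t 1 := by
  obtain ⟨⟨n', m', k'⟩, ht⟩ := t
  simp only [Prod.mk.injEq] at h
  obtain ⟨rfl, rfl, rfl⟩ := h
  exact kvec_of_pos ht

/-- The basis vector of the label `t = (n, m, k)` is `kvec S n m k`. [cite: Kovacevic2021, §3 Def. 1] -/
theorem single_eq_kvec (t : KIdx S) : Finsupp.single t (1 : ℂ) = kvec S t.1.1 t.1.2.1 t.1.2.2 :=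
  (kvec_eq_single t rfl).symm

end Carrier

/-! ## §2 The dictionary constants `cnorm N i = (−1)^i · N!/(N−i)!` -/

section Cnorm

/-- **The dictionary `u^{i+1}_{n,m} ↔ cnorm (n−1) i · X₀^{n−1−i} X₁^{i}`**: `cnorm N i = (−1)^i · N (N−1) ⋯ (N−i+1)` (signed falling
factorial), forced by Kovačević's normalisation `Y_α u^k = −u^{k+1}` against `E₁₀ · X₀^{a} X₁^{b} = a X₀^{a−1} X₁^{b+1}`.
[cite: Kovacevic2021, §3 Def. 1] -/
def cnorm (N i : ℕ) : ℂ := (-1) ^ i * (N.descFactorial i : ℂ)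

/-- `cnorm N i ≠ 0` for `i ≤ N`. [cite: Kovacevic2021, §3 Def. 1] -/
theorem cnorm_ne_zero {N i : ℕ} (h : i ≤ N) : cnorm N i ≠ 0 := by
  refine mul_ne_zero (pow_ne_zero _ (neg_ne_zero.mpr one_ne_zero)) ?_
  exact_mod_cast fun h0 => (not_lt.mpr h) (Nat.descFactorial_eq_zero_iff_lt.mp h0)

/-- The recursion `cnorm N (i+1) = −(N − i) · cnorm N i`. [cite: Kovacevic2021, §3 Def. 1] -/
theorem cnorm_succ {N i : ℕ} (h : i ≤ N) : cnorm N (i + 1) = -(((N : ℂ) - i) * cnorm N i) := by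
  rw [cnorm, cnorm, Nat.descFactorial_succ, Nat.cast_mul, Nat.cast_sub h, pow_succ]
  ring

/-- `cnorm N i / cnorm N i = 1` for `i ≤ N`. [cite: Kovacevic2021, §3 Def. 1] -/
theorem cnorm_div_self {N i : ℕ} (h : i ≤ N) : cnorm N i / cnorm N i = 1 :=
  div_self (cnorm_ne_zero h)

end Cnorm

/-! ## §3 The `K`-action on one `K`-type `V_{n,m}` in the `u`-basis: `cnorm⁻¹ · (det^a u^b Sym^{n−1}) · cnorm` -/

section KType

/-- **The matrix of `ρK(g)|V_{n,m}` in the `u`-basis**: `(cnorm i / cnorm l) · upqKTypeCoeff (n−1) a b g l i` with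
`a = (m − 3n + 3)/6`, `b = −m/3` — i.e. `D⁻¹ · (det(g₁₁)^a u(g)^b Sym^{n−1}(g₁₁)) · D`, `D = diag(cnorm)`; column `i` holds the
coordinates of `ρK(g) u^{i+1}`. [cite: BorelWallach2000, VI §4 4.7–4.8] [cite: Kovacevic2021, §6] -/
def kTypeMat (n m : ℤ) (g : (uFormGroup (Fin 2) (Fin 1)).maximalCompact) :
    Matrix (Fin ((n - 1).toNat + 1)) (Fin ((n - 1).toNat + 1)) ℂ :=
  Matrix.of fun l i => cnorm ((n - 1).toNat) i / cnorm ((n - 1).toNat) l *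
    upqKTypeCoeff ((n - 1).toNat) ((m - 3 * n + 3) / 6) (-(m / 3)) g l i

/-- Unfolding, entrywise. [cite: BorelWallach2000, VI §4 4.7–4.8] -/
theorem kTypeMat_apply (n m : ℤ) (g : (uFormGroup (Fin 2) (Fin 1)).maximalCompact) (l i : Fin ((n - 1).toNat + 1)) :
    kTypeMat n m g l i = cnorm ((n - 1).toNat) i / cnorm ((n - 1).toNat) l *
      upqKTypeCoeff ((n - 1).toNat) ((m - 3 * n + 3) / 6) (-(m / 3)) g l i := rfl

/-- `kTypeMat n m 1 = 1`. [cite: BorelWallach2000, VI §4 4.7–4.8] -/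
theorem kTypeMat_one (n m : ℤ) : kTypeMat n m 1 = 1 := by
  ext l i
  rw [kTypeMat_apply, upqKTypeCoeff_one, Matrix.one_apply]
  by_cases h : l = i
  · subst h
    rw [if_pos rfl, mul_one, cnorm_div_self (Nat.le_of_lt_succ l.2)]
  · rw [if_neg h, mul_zero]

/-- **Multiplicativity** `kTypeMat n m (g h) = kTypeMat n m g * kTypeMat n m h` (★ `upqKTypeCoeff_mul`; the `cnorm`-ratios
telescope). [cite: BorelWallach2000, VI §4 4.7–4.8] -/
theorem kTypeMat_mul (n m : ℤ) (g h : (uFormGroup (Fin 2) (Fin 1)).maximalCompact) :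
    kTypeMat n m (g * h) = kTypeMat n m g * kTypeMat n m h := by
  ext l i
  rw [kTypeMat_apply, upqKTypeCoeff_mul, Matrix.mul_apply, Matrix.mul_apply, Finset.mul_sum]
  refine Finset.sum_congr rfl fun j _ => ?_
  rw [kTypeMat_apply, kTypeMat_apply]
  have hj : cnorm ((n - 1).toNat) j ≠ 0 := cnorm_ne_zero (Nat.le_of_lt_succ j.2)
  field_simp

/-- Continuity of the entries `g ↦ kTypeMat n m g l i` on `K` (★ `continuous_upqKTypeCoeff_apply`). [cite: BorelWallach2000, 0 §2.5] -/
theorem continuous_kTypeMat_apply (n m : ℤ) (l i : Fin ((n - 1).toNat + 1)) :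
    Continuous fun g : (uFormGroup (Fin 2) (Fin 1)).maximalCompact => kTypeMat n m g l i := by
  simp only [kTypeMat_apply]
  exact continuous_const.mul (continuous_upqKTypeCoeff_apply _ _ _ l i)

/-- **The derivative of the entries along `exp tX`, `X ∈ 𝔨`** (★ `hasDerivAt_upqKTypeCoeff_expK`, scaled by the constant
`cnorm`-ratio). [cite: BorelWallach2000, 0 §2.5] -/
theorem hasDerivAt_kTypeMat_expK (n m : ℤ) (X : (uFormGroup (Fin 2) (Fin 1)).compactLie) (l i : Fin ((n - 1).toNat + 1)) :
    HasDerivAt (fun t : ℝ => kTypeMat n m ((uFormGroup (Fin 2) (Fin 1)).expK (t • X)) l i)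
      (cnorm ((n - 1).toNat) i / cnorm ((n - 1).toNat) l *
        (((((m - 3 * n + 3) / 6 : ℤ) : ℂ) * ((X : Matrix (Fin 2 ⊕ Fin 1) (Fin 2 ⊕ Fin 1) ℂ).toBlocks₁₁).trace +
            ((-(m / 3) : ℤ) : ℂ) * (X : Matrix (Fin 2 ⊕ Fin 1) (Fin 2 ⊕ Fin 1) ℂ).toBlocks₂₂ 0 0) * (if l = i then 1 else 0) +
          dSymPowerMat ((n - 1).toNat) ((X : Matrix (Fin 2 ⊕ Fin 1) (Fin 2 ⊕ Fin 1) ℂ).toBlocks₁₁) l i)) 0 := by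
  simp only [kTypeMat_apply]
  exact (hasDerivAt_upqKTypeCoeff_expK _ _ _ X l i).const_mul _

end KType

/-! ## §4 The `K`-action on `V = ⊕ V_{n,m}` -/

section Action

variable (S : Set (ℤ × ℤ))

/-- **The image of the basis vector `u^k_{n,m}` under `g ∈ K`**: `Σ_l kTypeMat n m g l (k−1) • u^{l+1}_{n,m}`.
[cite: BorelWallach2000, VI §4 4.7–4.8] [cite: Kovacevic2021, §6] -/
def kTypeImg (g : (uFormGroup (Fin 2) (Fin 1)).maximalCompact) : KIdx S → (KIdx S →₀ ℂ)
  | ⟨(n, m, k), h⟩ => ∑ l : Fin ((n - 1).toNat + 1),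
      kTypeMat n m g l ⟨(k - 1).toNat, by obtain ⟨-, h1, h2⟩ := h; dsimp only at h1 h2; omega⟩ •
        kvec S n m ((l : ℕ) + 1)

/-- **The `K`-action `ρK(g)` on `V`** as a linear map (linear extension of `kTypeImg`). [cite: BorelWallach2000, 0 §2.5] -/
def kTypeEnd (g : (uFormGroup (Fin 2) (Fin 1)).maximalCompact) : (KIdx S →₀ ℂ) →ₗ[ℂ] (KIdx S →₀ ℂ) :=
  Finsupp.linearCombination ℂ (kTypeImg S g)

variable {S}

/-- `ρK(g)` on a basis vector. [cite: BorelWallach2000, 0 §2.5] -/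
theorem kTypeEnd_single (g : (uFormGroup (Fin 2) (Fin 1)).maximalCompact) (t : KIdx S) (c : ℂ) :
    kTypeEnd S g (Finsupp.single t c) = c • kTypeImg S g t := by
  rw [kTypeEnd, Finsupp.linearCombination_single]

/-- `ρK(g) v = Σ_{t ∈ supp v} v_t • kTypeImg g t`. [cite: BorelWallach2000, 0 §2.5] -/
theorem kTypeEnd_apply (g : (uFormGroup (Fin 2) (Fin 1)).maximalCompact) (v : KIdx S →₀ ℂ) :
    kTypeEnd S g v = ∑ t ∈ v.support, v t • kTypeImg S g t := by
  rw [kTypeEnd, Finsupp.linearCombination_apply]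
  rfl

/-- **`ρK(g) u^{j+1}_{n,m} = Σ_l kTypeMat n m g l j • u^{l+1}_{n,m}`** (the `Fin`-indexed form used throughout).
[cite: BorelWallach2000, VI §4 4.7–4.8] -/
theorem kTypeEnd_kvec (g : (uFormGroup (Fin 2) (Fin 1)).maximalCompact) {n m : ℤ} (hnm : (n, m) ∈ S) (hn : 1 ≤ n)
    (j : Fin ((n - 1).toNat + 1)) :
    kTypeEnd S g (kvec S n m ((j : ℕ) + 1)) =
      ∑ l : Fin ((n - 1).toNat + 1), kTypeMat n m g l j • kvec S n m ((l : ℕ) + 1) := by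
  have hj := j.2
  have h : (n, m) ∈ S ∧ (1 : ℤ) ≤ (j : ℕ) + 1 ∧ ((j : ℕ) : ℤ) + 1 ≤ n := ⟨hnm, by omega, by omega⟩
  rw [kvec_of_pos h, kTypeEnd_single, one_smul]
  change (∑ l : Fin ((n - 1).toNat + 1),
      kTypeMat n m g l ⟨((((j : ℕ) : ℤ) + 1) - 1).toNat, _⟩ • kvec S n m ((l : ℕ) + 1)) = _
  refine Finset.sum_congr rfl fun l _ => ?_
  congr 2
  exact Fin.ext (by simp)

/-- `ρK(1) = id`. [cite: BorelWallach2000, 0 §2.5] -/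
theorem kTypeEnd_one : kTypeEnd S 1 = 1 := by
  refine Finsupp.lhom_ext fun t c => ?_
  obtain ⟨⟨n, m, k⟩, hS, hk, hkn⟩ := t
  dsimp only at hS hk hkn
  rw [Module.End.one_apply, kTypeEnd_single]
  change c • (∑ l : Fin ((n - 1).toNat + 1),
      kTypeMat n m 1 l ⟨(k - 1).toNat, _⟩ • kvec S n m ((l : ℕ) + 1)) = _
  rw [kTypeMat_one, Finset.sum_eq_single (⟨(k - 1).toNat, by omega⟩ : Fin ((n - 1).toNat + 1))]
  · rw [Matrix.one_apply_eq, one_smul, kvec_eq_single ⟨(n, m, k), hS, hk, hkn⟩ (by simp; omega),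
      Finsupp.smul_single_one]
  · intro l _ hl
    rw [Matrix.one_apply_ne hl, zero_smul]
  · intro h
    exact absurd (Finset.mem_univ _) h

/-- `ρK(g h) = ρK(g) ρK(h)`. [cite: BorelWallach2000, 0 §2.5] -/
theorem kTypeEnd_mul (g h : (uFormGroup (Fin 2) (Fin 1)).maximalCompact) :
    kTypeEnd S (g * h) = kTypeEnd S g * kTypeEnd S h := by
  refine Finsupp.lhom_ext fun t c => ?_
  obtain ⟨⟨n, m, k⟩, hS, hk, hkn⟩ := t
  dsimp only at hS hk hkn
  rw [Module.End.mul_apply, kTypeEnd_single, kTypeEnd_single, map_smul]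
  congr 1
  change (∑ l : Fin ((n - 1).toNat + 1), kTypeMat n m (g * h) l ⟨(k - 1).toNat, _⟩ • kvec S n m ((l : ℕ) + 1)) =
    kTypeEnd S g (∑ j : Fin ((n - 1).toNat + 1), kTypeMat n m h j ⟨(k - 1).toNat, _⟩ • kvec S n m ((j : ℕ) + 1))
  rw [map_sum]
  simp_rw [map_smul, kTypeEnd_kvec g hS (by omega), Finset.smul_sum, smul_smul]
  rw [Finset.sum_comm]
  refine Finset.sum_congr rfl fun l _ => ?_
  rw [← Finset.sum_smul, kTypeMat_mul, Matrix.mul_apply]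
  congr 1
  exact Finset.sum_congr rfl fun _ _ => mul_comm _ _

variable (S)

/-- **The representation `ρK : K →* End V`** of `K = U(2) × U(1)` on `V = ⊕ V_{n,m}`. [cite: BorelWallach2000, 0 §2.5] -/
def kTypeRep : Representation ℂ (uFormGroup (Fin 2) (Fin 1)).maximalCompact (KIdx S →₀ ℂ) where
  toFun := kTypeEnd S
  map_one' := kTypeEnd_one
  map_mul' := kTypeEnd_mul

variable {S}

/-- Unfolding. [cite: BorelWallach2000, 0 §2.5] -/
@[simp] theorem kTypeRep_apply (g : (uFormGroup (Fin 2) (Fin 1)).maximalCompact) : kTypeRep S g = kTypeEnd S g := rfl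

end Action

/-! ## §5 `K`-finiteness and weak continuity -/

section Finite

variable {S : Set (ℤ × ℤ)}

/-- The block of basis vectors of the `K`-type through the label `t = (n, m, k)`: `{u^1_{n,m}, …, u^n_{n,m}}` (a finite set).
[cite: Kovacevic2021, §3 Def. 1] -/
theorem kTypeImg_mem_span (g : (uFormGroup (Fin 2) (Fin 1)).maximalCompact) (t : KIdx S) :
    kTypeImg S g t ∈ Submodule.span ℂ
      (Set.range fun l : Fin ((t.1.1 - 1).toNat + 1) => kvec S t.1.1 t.1.2.1 ((l : ℕ) + 1)) := by
  obtain ⟨⟨n, m, k⟩, hS, hk, hkn⟩ := t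
  change (∑ l : Fin ((n - 1).toNat + 1), kTypeMat n m g l ⟨(k - 1).toNat, _⟩ • kvec S n m ((l : ℕ) + 1)) ∈ _
  exact Submodule.sum_mem _ fun l _ => Submodule.smul_mem _ _ (Submodule.subset_span ⟨l, rfl⟩)

/-- **`K`-finiteness**: the `K`-orbit of `v` lies in the span of the (finitely many) blocks through `supp v`.
[cite: BorelWallach2000, 0 §2.5] -/
theorem finiteDimensional_span_orbit (v : KIdx S →₀ ℂ) :
    FiniteDimensional ℂ (Submodule.span ℂ
      (Set.range fun g : (uFormGroup (Fin 2) (Fin 1)).maximalCompact => kTypeRep S g v)) := by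
  classical
  -- the finite set of basis vectors of the blocks through the support of `v`
  set B : Set (KIdx S →₀ ℂ) := ⋃ t ∈ (v.support : Set (KIdx S)),
    Set.range fun l : Fin ((t.1.1 - 1).toNat + 1) => kvec S t.1.1 t.1.2.1 ((l : ℕ) + 1) with hB
  have hBfin : B.Finite := Set.Finite.biUnion (Finset.finite_toSet _) fun t _ => Set.finite_range _
  haveI : FiniteDimensional ℂ (Submodule.span ℂ B) := FiniteDimensional.span_of_finite ℂ hBfin
  refine Submodule.finiteDimensional_of_le (S₂ := Submodule.span ℂ B) (Submodule.span_le.mpr ?_)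
  rintro _ ⟨g, rfl⟩
  refine (?_ : kTypeRep S g v ∈ Submodule.span ℂ B)
  rw [kTypeRep_apply, kTypeEnd_apply]
  refine Submodule.sum_mem _ fun t ht => Submodule.smul_mem _ _ ?_
  refine Submodule.span_mono ?_ (kTypeImg_mem_span g t)
  exact Set.subset_biUnion_of_mem (u := fun t : KIdx S =>
    Set.range fun l : Fin ((t.1.1 - 1).toNat + 1) => kvec S t.1.1 t.1.2.1 ((l : ℕ) + 1)) (Finset.mem_coe.mpr ht)

/-- The matrix coefficient of a basis vector: `ℓ (kTypeImg g t) = Σ_l kTypeMat … g l (k−1) · ℓ (u^{l+1})`.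
[cite: BorelWallach2000, 0 §2.5] -/
theorem apply_kTypeImg (ℓ : Module.Dual ℂ (KIdx S →₀ ℂ)) (g : (uFormGroup (Fin 2) (Fin 1)).maximalCompact)
    (n m k : ℤ) (h : (n, m) ∈ S ∧ 1 ≤ k ∧ k ≤ n) :
    ℓ (kTypeImg S g ⟨(n, m, k), h⟩) = ∑ l : Fin ((n - 1).toNat + 1),
      kTypeMat n m g l ⟨(k - 1).toNat, by obtain ⟨-, -, h2⟩ := h; omega⟩ * ℓ (kvec S n m ((l : ℕ) + 1)) := by
  change ℓ (∑ l : Fin ((n - 1).toNat + 1), kTypeMat n m g l ⟨(k - 1).toNat, _⟩ • kvec S n m ((l : ℕ) + 1)) = _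
  rw [map_sum]
  refine Finset.sum_congr rfl fun l _ => ?_
  rw [map_smul, smul_eq_mul]

/-- **Weak continuity**: every matrix coefficient `g ↦ ℓ (ρK(g) v)` is continuous on `K`. [cite: BorelWallach2000, 0 §2.5] -/
theorem continuous_coeff (v : KIdx S →₀ ℂ) (ℓ : Module.Dual ℂ (KIdx S →₀ ℂ)) :
    Continuous fun g : (uFormGroup (Fin 2) (Fin 1)).maximalCompact => ℓ (kTypeRep S g v) := by
  simp only [kTypeRep_apply, kTypeEnd_apply, map_sum, map_smul, smul_eq_mul]
  refine continuous_finsetSum _ fun t _ => continuous_const.mul ?_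
  obtain ⟨⟨n, m, k⟩, h⟩ := t
  simp only [apply_kTypeImg]
  exact continuous_finsetSum _ fun l _ => (continuous_kTypeMat_apply n m l _).mul continuous_const

end Finite

/-! ## §6 The `𝔨`-hypothesis: `ρ𝔤|_𝔨` acts on the `u`-basis by Kovačević's formulas -/

section Hyp

variable (S : Set (ℤ × ℤ))

/-- **`ρ𝔤|_𝔨` acts on the basis `u^k_{n,m}` by Kovačević's `u`-basis formulas** (§3 Def. 1 with the centre of `𝔤𝔩(3)` acting by `0`):
for block-diagonal `X = diag(X₁₁, x₂₂) ∈ 𝔨 = 𝔲(2) ⊕ 𝔲(1)`,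
`ρ𝔤(X) u^k = [((2x₀₀−x₁₁−x₂₂)/3)(n+1−2k) + ((x₀₀+x₁₁−2x₂₂)/3)(m−n−1+2k)/2] u^k − x₀₁ (k−1)(n+1−k) u^{k−1} − x₁₀ u^{k+1}`
(`H_α = E₀₀ − E₁₁ ↦ n+1−2k`, `H_β = E₁₁ − E₂₂ ↦ (m−n−1+2k)/2`, `X_α = E₀₁`, `Y_α = E₁₀`).  (Kovacevic2021, §3 Def. 1) — a route-posited
predicate of the engine line (the interface between this Kovačević-free file and `SU21ModulesFromKTypes`), not a result of the literature
(hence untagged). -/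
def ActsOnKTypes (ρ𝔤 : (uFormGroup (Fin 2) (Fin 1)).lie →ₗ⁅ℝ⁆ Module.End ℂ (KIdx S →₀ ℂ)) : Prop :=
  ∀ (X : (uFormGroup (Fin 2) (Fin 1)).compactLie) (n m k : ℤ), (n, m) ∈ S → 1 ≤ k → k ≤ n →
    ρ𝔤 (LieSubalgebra.inclusion (uFormGroup (Fin 2) (Fin 1)).compactLie_le_lie X) (kvec S n m k) =
      ((2 * (X : Matrix (Fin 2 ⊕ Fin 1) (Fin 2 ⊕ Fin 1) ℂ) (Sum.inl 0) (Sum.inl 0)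
            - (X : Matrix (Fin 2 ⊕ Fin 1) (Fin 2 ⊕ Fin 1) ℂ) (Sum.inl 1) (Sum.inl 1)
            - (X : Matrix (Fin 2 ⊕ Fin 1) (Fin 2 ⊕ Fin 1) ℂ) (Sum.inr 0) (Sum.inr 0)) / 3 * ((n : ℂ) + 1 - 2 * k)
        + ((X : Matrix (Fin 2 ⊕ Fin 1) (Fin 2 ⊕ Fin 1) ℂ) (Sum.inl 0) (Sum.inl 0)
            + (X : Matrix (Fin 2 ⊕ Fin 1) (Fin 2 ⊕ Fin 1) ℂ) (Sum.inl 1) (Sum.inl 1)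
            - 2 * (X : Matrix (Fin 2 ⊕ Fin 1) (Fin 2 ⊕ Fin 1) ℂ) (Sum.inr 0) (Sum.inr 0)) / 3 *
            (((m : ℂ) - n - 1 + 2 * k) / 2)) • kvec S n m k
      + (-((X : Matrix (Fin 2 ⊕ Fin 1) (Fin 2 ⊕ Fin 1) ℂ) (Sum.inl 0) (Sum.inl 1) *
          (((k : ℂ) - 1) * ((n : ℂ) + 1 - k)))) • kvec S n m (k - 1)
      + (-(X : Matrix (Fin 2 ⊕ Fin 1) (Fin 2 ⊕ Fin 1) ℂ) (Sum.inl 1) (Sum.inl 0)) • kvec S n m (k + 1)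

end Hyp

end Summit.HodgeConjecture.HodgeConjecture.Cruxes.H413.F0P3bKTypeIntegration

end
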